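import Summits.Parity.BatemanHorn.Theorems.RoughValueTransportBalancedSemiprimeLayerDegreeLeTwo
import Summits.Parity.BatemanHorn.Theorems.RoughValueTransportBalancedSemiprimeLayerRoughWindowLever
import Summits.Parity.BatemanHorn.Theorems.RoughValueTransportBalancedSemiprimeLayerRoughWindowTypeIDegOne
import Summits.Parity.BatemanHorn.Theorems.RoughValueTransportBalancedSemiprimeLayerRootLevelTransfer
import HarnessLib

/-!
# Line `rough-relaxed-divisor-sieve` — skeleton r4.2 (seat c2, prover-line-stmt-Parity-9469-c2-0)
# for the crux `BalancedSemiprimeLayer` (item stmt-Parity-9469, route `RoughValueTransport`)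

Crux (by name, concluded by `BalancedSemiprimeLayer_of` below):
`Summit.Parity.BatemanHorn.Theses.RoughValueTransport.BalancedSemiprimeLayer`.

## State (r4, 2026-08-16T21:00Z): the residual is a statement about ONE polynomial

r3 (companion seat c1) closed the crux BY NAME modulo the single Type-I stub S7
`stub_roughWindowTypeI_highDegree` (`RoughWindowTypeI f i` for coordinates of degree `≥ 3`), through
the LANDED lever `stub_roughWindowLever` (p107548) and the LANDED transfer `stub_transfer` (p78616).
`RoughWindowTypeI f i` still speaks about the SYSTEM (`posRange f x`, the twist `e ∣ ∏ⱼ fⱼ(n)`, the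
main term `x·ρᵢ(m)/m·ρ_F(e)/e`).  r4 strips that:

* S9 `stub_rootLevelTransfer` (seat c2, LANDED p125151 as
  `Theorems/RoughValueTransportBalancedSemiprimeLayerRootLevelTransfer.lean`): for every coordinate of
  degree `≥ 2` of a Bateman–Horn system, the single-polynomial root-level statement for `g = fᵢ`
  implies `RoughWindowTypeI f i` (fibre over the classes of `∏ fⱼ` mod `e`; the onset of positivity
  costs `∑_{n<n₀} |g(n)|·x^c` because an irreducible `g` of degree `≥ 2` has no integer root).
* S8 `stub_roughWindowRootLevel_highDegree` — THE RESIDUAL (OPEN), now for ONE irreducible `g` of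
  degree `≥ 3` with positive leading coefficient: the roots of `g` modulo the rough squarefree moduli
  `m` of the balanced window `[x^{d(1−δ)/2}, x^{d(1+δ)/2}]` (`d = deg g`, every prime of `m` `> x^c`)
  are as many in the initial segment `[1, x]` of each progression `s mod e` as `(x/e)·ρ_g(m)/m`
  predicts, summed over the window INSIDE the absolute value, over all classes `s` and all squarefree
  `e ≤ x^c` outside, with a power saving `x^{1−η}`.  No system, no Bateman–Horn constant, no
  `posRange`, no product, no sieve, no primes.  Moduli `m ≥ x^{9/8} > x`: root equidistribution
  BEYOND the number of terms, uniformly in frequencies `≤ m/x` — in print only with log-savings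
  (Hooley 1964) for `d ≥ 3`; this is what the crux is closed modulo, verbatim for the planner.
* KEPT registered verbatim: S7 `stub_roughWindowTypeI_highDegree` (r3) and S6
  `stub_coordLayerThin_highDegree` (r1) — each is moreover a THEOREM of S8 (through S9, the lever)
  in this file, so a supplier of ANY of S8 / S7 / S6 closes the crux through a landed composition.

Disproof.lean (gen 2 rev 6, 05:22Z) re-read at 20:20Z: `-- Targets` concern S6 only ("SURVIVES —
open problem in both directions"); load-bearing hypotheses honoured (irreducibility is now used
TWICE: `ρᵢ(p) ≤ dᵢ` in the lever and "no integer root" in S9); no refuted strengthening instantiated.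
-/

noncomputable section

open Polynomial Filter Finset
open Literature.NumberTheory.Sieve
open scoped BigOperators

namespace Summit.Parity.BatemanHorn.Cruxes.BalancedSemiprimeLayer.RoughRelaxedDivisorSieve

open Summit.Parity.BatemanHorn.Theses.RoughValueTransport (BalancedSemiprimeLayer)
open Summit.Parity.BatemanHorn.Cruxes.BalancedSemiprimeLayer.SmoothModulusTwistedHooley
  (coordLayer CoordLayerThin stub_transfer)

/-! ### Registered stubs (`sorry` lives ONLY in `stub_*`) -/

/-- **S8 `stub_roughWindowRootLevel_highDegree` — THE RESIDUAL (OPEN; one polynomial).**  For every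
irreducible `g ∈ ℤ[X]` of degree `d ≥ 3` with positive leading coefficient there is `c₀ > 0` such that
for all `0 < c ≤ c₀`, `0 < δ ≤ c` some `η > 0` has, eventually in `x`,
`∑_{e ≤ x^c squarefree} ∑_{s mod e} |∑_{m ∈ roughDivWindow d δ c x} (#{1 ≤ n ≤ x : n ≡ s (e), m ∣ g(n)} − (x/e)·ρ_g(m)/m)| ≤ x^{1−η}`.
Moduli `m ≥ x^{d(1−δ)/2} ≥ x^{9/8} > x`: equidistribution of the roots of `g mod m` in the initial
segment `[1, x] ⊊ [1, m]` with power saving, on average over the rough squarefree window — not in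
print (Hooley 1964: log-saving at fixed frequency).  Leans on: nothing available (conjecture item). -/
theorem stub_roughWindowRootLevel_highDegree :
    ∀ g : ℤ[X], Irreducible g → 0 < g.leadingCoeff → 3 ≤ g.natDegree →
      ∃ c₀ : ℝ, 0 < c₀ ∧ ∀ c : ℝ, 0 < c → c ≤ c₀ → ∀ δ : ℝ, 0 < δ → δ ≤ c →
        ∃ η : ℝ, 0 < η ∧ ∀ᶠ x : ℕ in Filter.atTop,
          (∑ e ∈ (Finset.Icc 1 ⌊(x : ℝ) ^ c⌋₊).filter Squarefree, ∑ s ∈ Finset.range e,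
            |∑ m ∈ roughDivWindow g.natDegree δ c x,
              ((#((Finset.Ioc 0 x).filter fun n : ℕ =>
                  n ≡ s [MOD e] ∧ (m : ℤ) ∣ g.eval (n : ℤ)) : ℝ) -
                (x : ℝ) / e * ((polyRootCountMod ![g] m : ℝ) / m))|) ≤ (x : ℝ) ^ (1 - η) := by
  sorry

/-! S9 `stub_rootLevelTransfer` (seat c2) is LANDED: p125151,
`Theorems/RoughValueTransportBalancedSemiprimeLayerRootLevelTransfer.lean` (imported above). -/

/-- **S7 `stub_roughWindowTypeI_highDegree`** (r3's residual, kept registered verbatim): for every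
Bateman–Horn system and every coordinate of degree `≥ 3`, the rough balanced-divisor line has level
`x^c` in the sense of `RoughWindowTypeI`.  In r4 it is ALSO a theorem of S8 and S9
(`roughWindowTypeI_highDegree_of_rootLevel`). -/
theorem stub_roughWindowTypeI_highDegree :
    ∀ (k : ℕ) (f : Fin k → ℤ[X]), IsBatemanHornSystem f → ∀ i : Fin k,
      3 ≤ (f i).natDegree → RoughWindowTypeI f i := by
  sorry

/-- **S6 `stub_coordLayerThin_highDegree`** — r1's stub VERBATIM (seats -2 and -3; kept registered): the
crux's degree-`≥ 3` residue in unfolded route vocabulary (= RHS of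
`Split.balancedSemiprimeLayer_iff_higherLayer_unfolded`, crux-EQUIVALENT).  In r4 it is ALSO a theorem of
S8 and S9 (`coordLayerThin_highDegree_of_rootLevel`). -/
theorem stub_coordLayerThin_highDegree :
    ∀ (k : ℕ) (f : Fin k → Polynomial ℤ), Literature.NumberTheory.Sieve.IsBatemanHornSystem f →
      ∀ i : Fin k, 3 ≤ (f i).natDegree → ∀ ε : ℝ, 0 < ε → ∃ δ : ℝ, 0 < δ ∧ δ ≤ 1 / 4 ∧
        ∀ᶠ x : ℕ in Filter.atTop,
          (((Finset.Icc 1 x).filter (fun n : ℕ => (∀ j, 0 < (f j).eval (n : ℤ) ∧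
              ∀ p ∈ Finset.range ⌈(x : ℝ) ^ (((f j).natDegree : ℝ) * (1 - δ) / 2)⌉₊,
                p.Prime → ¬ ((p : ℤ) ∣ (f j).eval (n : ℤ))) ∧
              ¬ ((f i).eval (n : ℤ)).toNat.Prime)).card : ℝ) ≤ ε * (x : ℝ) / Real.log x ^ k := by
  sorry

/-- **S10 `stub_cruxOfRootLevel`** (seat c2; transfer stub, PROVED in `work/stubs/OfRootLevel.lean`, target
`Theorems/RoughValueTransportBalancedSemiprimeLayerOfRootLevel.lean`): the crux from S8's statement by landed
theorems only (S9 p125151, lever p107548, transfer p78616) — the composition of this skeleton as a tree theorem,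
so that the crux closes `--by stub_cruxOfRootLevel T` the moment S8 is a theorem `T`. -/
theorem stub_cruxOfRootLevel :
    (∀ g : ℤ[X], Irreducible g → 0 < g.leadingCoeff → 3 ≤ g.natDegree →
      ∃ c₀ : ℝ, 0 < c₀ ∧ ∀ c : ℝ, 0 < c → c ≤ c₀ → ∀ δ : ℝ, 0 < δ → δ ≤ c →
        ∃ η : ℝ, 0 < η ∧ ∀ᶠ x : ℕ in Filter.atTop,
          (∑ e ∈ (Finset.Icc 1 ⌊(x : ℝ) ^ c⌋₊).filter Squarefree, ∑ s ∈ Finset.range e,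
            |∑ m ∈ roughDivWindow g.natDegree δ c x,
              ((#((Finset.Ioc 0 x).filter fun n : ℕ =>
                  n ≡ s [MOD e] ∧ (m : ℤ) ∣ g.eval (n : ℤ)) : ℝ) -
                (x : ℝ) / e * ((polyRootCountMod ![g] m : ℝ) / m))|) ≤ (x : ℝ) ^ (1 - η)) →
      BalancedSemiprimeLayer := by
  sorry

/-! ### Composition (sorry-free apart from the stubs it names) -/

/-- S7 from S8 and S9: `RoughWindowTypeI` for a coordinate of degree `≥ 3` from the single-polynomial
residual for that coordinate. -/
theorem roughWindowTypeI_highDegree_of_rootLevel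
    (h8 : ∀ g : ℤ[X], Irreducible g → 0 < g.leadingCoeff → 3 ≤ g.natDegree →
      ∃ c₀ : ℝ, 0 < c₀ ∧ ∀ c : ℝ, 0 < c → c ≤ c₀ → ∀ δ : ℝ, 0 < δ → δ ≤ c →
        ∃ η : ℝ, 0 < η ∧ ∀ᶠ x : ℕ in Filter.atTop,
          (∑ e ∈ (Finset.Icc 1 ⌊(x : ℝ) ^ c⌋₊).filter Squarefree, ∑ s ∈ Finset.range e,
            |∑ m ∈ roughDivWindow g.natDegree δ c x,
              ((#((Finset.Ioc 0 x).filter fun n : ℕ =>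
                  n ≡ s [MOD e] ∧ (m : ℤ) ∣ g.eval (n : ℤ)) : ℝ) -
                (x : ℝ) / e * ((polyRootCountMod ![g] m : ℝ) / m))|) ≤ (x : ℝ) ^ (1 - η)) :
    ∀ (k : ℕ) (f : Fin k → ℤ[X]), IsBatemanHornSystem f → ∀ i : Fin k,
      3 ≤ (f i).natDegree → RoughWindowTypeI f i :=
  fun k f hf i hi => stub_rootLevelTransfer k f hf i ((Nat.le_succ 2).trans hi)
    (h8 (f i) (hf.irreducible i) (hf.leadingCoeff_pos i) hi)

/-- S6 (r1's stub) from S8 and S9 through the LANDED lever (definitional unfolding of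
`CoordLayerThin`, `coordLayer`). -/
theorem coordLayerThin_highDegree_of_rootLevel
    (h8 : ∀ g : ℤ[X], Irreducible g → 0 < g.leadingCoeff → 3 ≤ g.natDegree →
      ∃ c₀ : ℝ, 0 < c₀ ∧ ∀ c : ℝ, 0 < c → c ≤ c₀ → ∀ δ : ℝ, 0 < δ → δ ≤ c →
        ∃ η : ℝ, 0 < η ∧ ∀ᶠ x : ℕ in Filter.atTop,
          (∑ e ∈ (Finset.Icc 1 ⌊(x : ℝ) ^ c⌋₊).filter Squarefree, ∑ s ∈ Finset.range e,
            |∑ m ∈ roughDivWindow g.natDegree δ c x,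
              ((#((Finset.Ioc 0 x).filter fun n : ℕ =>
                  n ≡ s [MOD e] ∧ (m : ℤ) ∣ g.eval (n : ℤ)) : ℝ) -
                (x : ℝ) / e * ((polyRootCountMod ![g] m : ℝ) / m))|) ≤ (x : ℝ) ^ (1 - η)) :
    ∀ (k : ℕ) (f : Fin k → Polynomial ℤ), Literature.NumberTheory.Sieve.IsBatemanHornSystem f →
      ∀ i : Fin k, 3 ≤ (f i).natDegree → ∀ ε : ℝ, 0 < ε → ∃ δ : ℝ, 0 < δ ∧ δ ≤ 1 / 4 ∧
        ∀ᶠ x : ℕ in Filter.atTop,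
          (((Finset.Icc 1 x).filter (fun n : ℕ => (∀ j, 0 < (f j).eval (n : ℤ) ∧
              ∀ p ∈ Finset.range ⌈(x : ℝ) ^ (((f j).natDegree : ℝ) * (1 - δ) / 2)⌉₊,
                p.Prime → ¬ ((p : ℤ) ∣ (f j).eval (n : ℤ))) ∧
              ¬ ((f i).eval (n : ℤ)).toNat.Prime)).card : ℝ) ≤ ε * (x : ℝ) / Real.log x ^ k :=
  fun k f hf i hi => stub_roughWindowLever k f hf i
    (roughWindowTypeI_highDegree_of_rootLevel h8 k f hf i hi)

/-- **THE COMPOSITION (r4).**  `BalancedSemiprimeLayer` BY NAME from the single-polynomial residual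
S8 through S9 (this seat), the LANDED lever `stub_roughWindowLever` (p107548) and the LANDED transfer
`stub_transfer` (p78616: glue `Φ_f ≤ P_f + Σᵢ Eᵢ`, `ε/k`, least `δ`, `k = 0` slice, degree `≤ 2` by
the landed stubs of line `smooth-modulus-twisted-hooley`).  `sorryAx` enters exactly through
`stub_roughWindowRootLevel_highDegree` (S9 is the landed p125151). -/
theorem BalancedSemiprimeLayer_of : BalancedSemiprimeLayer :=
  stub_transfer fun k f hf i hi =>
    stub_roughWindowLever k f hf i
      (roughWindowTypeI_highDegree_of_rootLevel stub_roughWindowRootLevel_highDegree k f hf i hi)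

/-- The crux through the transfer stub S10 (identical content to `BalancedSemiprimeLayer_of`, packaged). -/
theorem BalancedSemiprimeLayer_of_viaS10 : BalancedSemiprimeLayer :=
  stub_cruxOfRootLevel stub_roughWindowRootLevel_highDegree

/-- **r3's composition, kept** (companion seat c1): the crux BY NAME from S7 alone. -/
theorem BalancedSemiprimeLayer_of' : BalancedSemiprimeLayer :=
  stub_transfer fun k f hf i hi =>
    stub_roughWindowLever k f hf i (stub_roughWindowTypeI_highDegree k f hf i hi)

/-- **r1's composition, kept** (seats -2 and -3): the crux BY NAME from S6 alone. -/
theorem BalancedSemiprimeLayer_of'' : BalancedSemiprimeLayer :=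
  stub_transfer stub_coordLayerThin_highDegree

/-- The linear layer through THIS line, unconditionally (LANDED lever + LANDED degree-1 Type-I,
p107054). -/
theorem coordLayerThin_of_natDegree_eq_one {k : ℕ} {f : Fin k → ℤ[X]} (hf : IsBatemanHornSystem f)
    (i : Fin k) (h1 : (f i).natDegree = 1) : CoordLayerThin f i :=
  stub_roughWindowLever k f hf i (stub_roughWindowTypeI_degOne k f hf i h1)

end Summit.Parity.BatemanHorn.Cruxes.BalancedSemiprimeLayer.RoughRelaxedDivisorSieve
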